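import Literature.Probability.Percolation.IsoradialArmComparisonProofs
import HarnessLib

/-!
# "(exp_equiv_a)–(exp_equiv_b), iterated": changing the radii of an arm event by bounded factors

Proofs-only support file (theorems only; no definition, no named fact) for the two named facts
transcribing Grimmett–Manolescu, *Bond percolation on isoradial graphs: criticality and
universality*, PTRF 159 (2014) 273–327 = arXiv:1204.0505, §8.1 Prop. (exp_transport):
`GrimmettManolescu2014_armComparability_one_two` (`k ∈ {1, 2}`, `IsoradialArmComparability`)
and `GrimmettManolescu2014_altArmComparability` (`k = 2j ≥ 4`, `IsoradialArmComparison`).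

The printed proof of Prop. (exp_transport) (§8.3 Lemma (exp_transport1), §8.4 Lemma 26, §8.5.2
twice) transports an arm event of the annulus `𝒜(N, n)` of one graph to an arm event of a
*shrunken* annulus `𝒜(c_d N, c_d⁻¹ n)` of another (`c_d = c_d(ε)` the constant of the
equivalence of metrics, Prop. 7), and then restores the radii at the cost of a constant factor
"by (exp_equiv_a) and (exp_equiv_b), iterated" — (exp_equiv_a):
`P_G[A_k(N, 2n)] ≤ P_G[A_k(N, n)] ≤ c₁ P_G[A_k(N, 2n)]`, (exp_equiv_b):
`P_G[A_k(N, n)] ≤ P_G[A_k(2N, n)] ≤ c₂ P_G[A_k(N, n)]`, "for `n > N` sufficiently large", i.e.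
(§8.1) "for `n ≥ c₀N` and `N > N₀`". This file is that iteration, once and for all, as a lemma
about a two-parameter family `u N n` (§1), and its instances for the probabilities of the tree's
arm events (§2): `u N n = P_G[emb.embAltArmEvent j N n]` (the cluster-separated alternating
`2j`-arm events of `IsoradialArmUniversality`, behind `GrimmettManolescu2014_altArmComparability`)
and `u N n = P_G[emb.embArmEvent κ N n]` (behind `GrimmettManolescu2014_armComparability_one_two`),
whose first (inclusion) halves of (exp_equiv_a), (exp_equiv_b) are the landed monotonicities
`embAltArmProb_outer_anti` / `embAltArmProb_inner_mono` (`IsoradialArmComparisonProofs`) and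
`embArmProb_outer_anti` / `embArmProb_inner_mono` (`IsoradialArmComparabilityProofs`). The deep
halves (the constants `c₁`, `c₂`; §8.5.2: "follow from Theorem (separation) and the
box-crossing property") enter as hypotheses, in the printed shape and scope.

## Contents (all proved)

* `ArmScaleIteration.iterate_outer` — from (exp_equiv_a): `u N n ≤ c₁ⁱ · u N (2ⁱ n)` in scope;
  `ArmScaleIteration.iterate_inner` — from (exp_equiv_b): `u (2ⁱ N) n ≤ c₂ⁱ · u N n` in scope.
* `ArmScaleIteration.shrink_le` — **the iterated form**: if `u` is antitone in the outer and
  monotone in the inner radius (on non-degenerate annuli) and satisfies (exp_equiv_a),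
  (exp_equiv_b) with constants `c₁, c₂` for `N ≥ N₀`, `n ≥ c₀N` (resp. `n ≥ c₀ · 2N`), then for
  `N₀ ≤ N ≤ N' ≤ 2ᵗN`, `n' ≤ n ≤ 2ᵗn'` and `c₀ 2ᵗ N' ≤ n'`:
  `u N' n' ≤ (c₁c₂)ᵗ · u N n` — shrinking the annulus by factors at most `2ᵗ` on either side
  costs at most `(c₁c₂)ᵗ`; `ArmScaleIteration.exists_shrink_le` — the same for an arbitrary
  factor `K` with some constant `C = C(K, c₁, c₂) > 0` and scope `c N' ≤ n'`, `c = c₀ 2^K`.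
* `RhombicEmbedding.embAltArmProb_shrink_le`, `RhombicEmbedding.exists_embAltArmProb_shrink_le` —
  the instances for `P_G[A_{2j}(N, n)] = P_G[emb.embAltArmEvent j N n]` (`k = 2j ≥ 4` line);
  `RhombicEmbedding.embArmProb_shrink_le'`, `RhombicEmbedding.exists_embArmProb_shrink_le` — the
  instances for `P_G[A_κ(N, n)] = emb.embArmProb κ N n` (`k ∈ {1, 2}` line).

## References

* G. R. Grimmett, I. Manolescu, PTRF 159 (2014) 273–327 = arXiv:1204.0505: §8.1 (scope
  convention "for `n > N` sufficiently large"), §8.2 Prop. (exp_equiv) (a), (b), §8.3–§8.5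
  ("by (exp_equiv_a) and (exp_equiv_b), iterated") [GrimmettManolescu2014Isoradial].
* P. Nolin, *Near-critical percolation in two dimensions*, EJP 13 (2008), §4
  (extendability; changing radii by bounded factors) [Nolin2008].
-/

noncomputable section

namespace Literature.Probability.Percolation

open LatticeModels

/-! ### §1 The iteration for a two-parameter family -/

namespace ArmScaleIteration

variable {u : ℕ → ℕ → ℝ}

/-- **(exp_equiv_a) iterated**: if `u N n ≤ c₁ · u N (2n)` whenever `N ≥ N₀` and `n ≥ c₀N`,
then `u N n ≤ c₁ⁱ · u N (2ⁱn)` in the same scope.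
[cite: GrimmettManolescu2014Isoradial, §8.2 Prop. (exp_equiv) (a), iterated (§8.3)] -/
theorem iterate_outer {c₁ : ℝ} (hc₁ : 0 ≤ c₁) {c₀ N₀ : ℕ}
    (ha : ∀ N n, N₀ ≤ N → c₀ * N ≤ n → u N n ≤ c₁ * u N (2 * n))
    {N n : ℕ} (hN : N₀ ≤ N) (hn : c₀ * N ≤ n) (i : ℕ) :
    u N n ≤ c₁ ^ i * u N (2 ^ i * n) := by
  induction i with
  | zero => simp
  | succ i ih =>
    have hscope : c₀ * N ≤ 2 ^ i * n := hn.trans (Nat.le_mul_of_pos_left n (Nat.two_pow_pos i))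
    have step := ha N (2 ^ i * n) hN hscope
    have h2 : 2 * (2 ^ i * n) = 2 ^ (i + 1) * n := by ring
    rw [h2] at step
    calc u N n ≤ c₁ ^ i * u N (2 ^ i * n) := ih
      _ ≤ c₁ ^ i * (c₁ * u N (2 ^ (i + 1) * n)) := mul_le_mul_of_nonneg_left step (pow_nonneg hc₁ i)
      _ = c₁ ^ (i + 1) * u N (2 ^ (i + 1) * n) := by rw [pow_succ]; ring

/-- **(exp_equiv_b) iterated**: if `u (2N) n ≤ c₂ · u N n` whenever `N ≥ N₀` and `n ≥ c₀ · 2N`,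
then `u (2ⁱN) n ≤ c₂ⁱ · u N n` whenever `N ≥ N₀` and `n ≥ c₀ 2ⁱ N`.
[cite: GrimmettManolescu2014Isoradial, §8.2 Prop. (exp_equiv) (b), iterated (§8.3)] -/
theorem iterate_inner {c₂ : ℝ} (hc₂ : 0 ≤ c₂) {c₀ N₀ : ℕ}
    (hb : ∀ N n, N₀ ≤ N → c₀ * (2 * N) ≤ n → u (2 * N) n ≤ c₂ * u N n)
    {N n : ℕ} (hN : N₀ ≤ N) (i : ℕ) (hn : c₀ * (2 ^ i * N) ≤ n) :
    u (2 ^ i * N) n ≤ c₂ ^ i * u N n := by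
  induction i with
  | zero => simp
  | succ i ih =>
    have hNi : N₀ ≤ 2 ^ i * N := hN.trans (Nat.le_mul_of_pos_left N (Nat.two_pow_pos i))
    have h2 : 2 * (2 ^ i * N) = 2 ^ (i + 1) * N := by ring
    have hscope : c₀ * (2 * (2 ^ i * N)) ≤ n := by rw [h2]; exact hn
    have hn' : c₀ * (2 ^ i * N) ≤ n := by
      refine le_trans (Nat.mul_le_mul_left _ (Nat.mul_le_mul_right _ ?_)) hn
      exact Nat.pow_le_pow_right Nat.two_pos i.le_succ
    have step := hb (2 ^ i * N) n hNi hscope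
    rw [h2] at step
    calc u (2 ^ (i + 1) * N) n ≤ c₂ * u (2 ^ i * N) n := step
      _ ≤ c₂ * (c₂ ^ i * u N n) := mul_le_mul_of_nonneg_left (ih hn') hc₂
      _ = c₂ ^ (i + 1) * u N n := by rw [pow_succ]; ring

/-- **"By (exp_equiv_a) and (exp_equiv_b), iterated."** Let `u N n` be antitone in the outer
radius and monotone in the inner radius on non-degenerate annuli (`N ≤ n`), and satisfy
(exp_equiv_a) `u N n ≤ c₁ · u N (2n)` for `N ≥ N₀`, `n ≥ c₀N` and (exp_equiv_b)
`u (2N) n ≤ c₂ · u N n` for `N ≥ N₀`, `n ≥ c₀ · 2N`. Then shrinking the annulus `(N, n)` to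
`(N', n')` with `N ≤ N' ≤ 2ᵗN` and `n' ≤ n ≤ 2ᵗn'` costs at most the factor `(c₁c₂)ᵗ`:
`u N' n' ≤ (c₁c₂)ᵗ · u N n`, provided `N ≥ N₀` and `n' ≥ c₀ 2ᵗ N'`. (Route, as in §8.3: push
the outer radius of the small annulus out by (a) `t` times and come back to `n` by
antitonicity; raise the inner radius `N` to `2ᵗN ≥ N'` by monotonicity and pay (b) `t` times.)
[cite: GrimmettManolescu2014Isoradial, §8.3 proof of Lemma (exp_transport1) ("by (exp_equiv_a) and (exp_equiv_b), iterated"); §8.4; §8.5.2] -/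
theorem shrink_le (hout : ∀ N n n', N ≤ n → n ≤ n' → u N n' ≤ u N n)
    (hin : ∀ N N' n, N ≤ N' → N' ≤ n → u N n ≤ u N' n)
    {c₁ c₂ : ℝ} (hc₁ : 0 ≤ c₁) (hc₂ : 0 ≤ c₂) {c₀ N₀ : ℕ} (hc₀ : 1 ≤ c₀)
    (ha : ∀ N n, N₀ ≤ N → c₀ * N ≤ n → u N n ≤ c₁ * u N (2 * n))
    (hb : ∀ N n, N₀ ≤ N → c₀ * (2 * N) ≤ n → u (2 * N) n ≤ c₂ * u N n)
    (t : ℕ) {N N' n' n : ℕ} (hN : N₀ ≤ N) (hNN' : N ≤ N') (hN'K : N' ≤ 2 ^ t * N)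
    (hn'n : n' ≤ n) (hnK : n ≤ 2 ^ t * n') (hsc : c₀ * 2 ^ t * N' ≤ n') :
    u N' n' ≤ (c₁ * c₂) ^ t * u N n := by
  have h2t : 1 ≤ 2 ^ t := Nat.one_le_two_pow
  have hN' : N₀ ≤ N' := hN.trans hNN'
  -- `N' ≤ c₀ 2ᵗ N' ≤ n' ≤ n`
  have hN'le : N' ≤ c₀ * 2 ^ t * N' := by
    calc N' = 1 * 1 * N' := by ring
      _ ≤ c₀ * 2 ^ t * N' := Nat.mul_le_mul_right _ (Nat.mul_le_mul hc₀ h2t)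
  have h1 : c₀ * N' ≤ n' := by
    refine le_trans ?_ hsc
    calc c₀ * N' = c₀ * 1 * N' := by ring
      _ ≤ c₀ * 2 ^ t * N' := Nat.mul_le_mul_right _ (Nat.mul_le_mul_left _ h2t)
  have hN'n : N' ≤ n := (hN'le.trans hsc).trans hn'n
  have h2tN : 2 ^ t * N ≤ n := by
    calc 2 ^ t * N ≤ 2 ^ t * N' := Nat.mul_le_mul_left _ hNN'
      _ = 1 * 2 ^ t * N' := by ring
      _ ≤ c₀ * 2 ^ t * N' := Nat.mul_le_mul_right _ (Nat.mul_le_mul_right _ hc₀)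
      _ ≤ n := hsc.trans hn'n
  have hsc' : c₀ * (2 ^ t * N) ≤ n := by
    calc c₀ * (2 ^ t * N) = c₀ * 2 ^ t * N := by ring
      _ ≤ c₀ * 2 ^ t * N' := Nat.mul_le_mul_left _ hNN'
      _ ≤ n := hsc.trans hn'n
  have s1 : u N' n' ≤ c₁ ^ t * u N' (2 ^ t * n') := iterate_outer hc₁ ha hN' h1 t
  have s2 : u N' (2 ^ t * n') ≤ u N' n := hout N' n (2 ^ t * n') hN'n hnK
  have s3 : u N' n ≤ u (2 ^ t * N) n := hin N' (2 ^ t * N) n hN'K h2tN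
  have s4 : u (2 ^ t * N) n ≤ c₂ ^ t * u N n := iterate_inner hc₂ hb hN t hsc'
  have hc₁t : 0 ≤ c₁ ^ t := pow_nonneg hc₁ t
  calc u N' n' ≤ c₁ ^ t * u N' (2 ^ t * n') := s1
    _ ≤ c₁ ^ t * u N' n := mul_le_mul_of_nonneg_left s2 hc₁t
    _ ≤ c₁ ^ t * u (2 ^ t * N) n := mul_le_mul_of_nonneg_left s3 hc₁t
    _ ≤ c₁ ^ t * (c₂ ^ t * u N n) := mul_le_mul_of_nonneg_left s4 hc₁t
    _ = (c₁ * c₂) ^ t * u N n := by rw [mul_pow]; ring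

/-- **Shrinking by an arbitrary bounded factor `K`.** Under the hypotheses of `shrink_le` there
are `C = C(K, c₁, c₂) > 0` and `c = c₀ 2^K ≥ 1` such that `u N' n' ≤ C · u N n` whenever
`N₀ ≤ N ≤ N' ≤ KN`, `n' ≤ n ≤ Kn'` and `cN' ≤ n'` — the form in which §8 passes from
`P[A_k(c_d N, c_d⁻¹ n)]` back to `P[A_k(N, n)]` at the cost "`c₄`".
[cite: GrimmettManolescu2014Isoradial, §8.3 ("≤ c₃c₄ P[A_k(N, n)], by (exp_equiv_a) and (exp_equiv_b), iterated")] -/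
theorem exists_shrink_le (hout : ∀ N n n', N ≤ n → n ≤ n' → u N n' ≤ u N n)
    (hin : ∀ N N' n, N ≤ N' → N' ≤ n → u N n ≤ u N' n)
    {c₁ c₂ : ℝ} (hc₁ : 0 < c₁) (hc₂ : 0 < c₂) {c₀ N₀ : ℕ} (hc₀ : 1 ≤ c₀)
    (ha : ∀ N n, N₀ ≤ N → c₀ * N ≤ n → u N n ≤ c₁ * u N (2 * n))
    (hb : ∀ N n, N₀ ≤ N → c₀ * (2 * N) ≤ n → u (2 * N) n ≤ c₂ * u N n) (K : ℕ) :
    ∃ C > (0 : ℝ), ∃ c : ℕ, 1 ≤ c ∧ ∀ N N' n' n : ℕ, N₀ ≤ N → N ≤ N' → N' ≤ K * N →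
      n' ≤ n → n ≤ K * n' → c * N' ≤ n' → u N' n' ≤ C * u N n := by
  have hK : K ≤ 2 ^ K := (Nat.lt_two_pow_self).le
  refine ⟨(c₁ * c₂) ^ K, pow_pos (mul_pos hc₁ hc₂) K, c₀ * 2 ^ K,
    le_trans hc₀ (Nat.le_mul_of_pos_right _ (Nat.two_pow_pos K)), ?_⟩
  intro N N' n' n hN hNN' hN'K hn'n hnK hsc
  exact shrink_le hout hin hc₁.le hc₂.le hc₀ ha hb K hN hNN'
    (hN'K.trans (Nat.mul_le_mul_right _ hK)) hn'n (hnK.trans (Nat.mul_le_mul_right _ hK)) hsc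

end ArmScaleIteration

/-! ### §2 Instances for the arm events of an isoradial graph -/

section Isoradial

open ArmScaleIteration

variable {V F : Type*} {G : SimpleGraph V} (emb : RhombicEmbedding G F)

/-- **(exp_equiv_a)–(exp_equiv_b) iterated, for the alternating `2j`-arm events**
(`k = 2j ≥ 4` line of Prop. (exp_transport)). If `P_G[A_{2j}(N, n)] ≤ c₁ P_G[A_{2j}(N, 2n)]`
for `N ≥ N₀`, `n ≥ c₀N`, and `P_G[A_{2j}(2N, n)] ≤ c₂ P_G[A_{2j}(N, n)]` for `N ≥ N₀`,
`n ≥ c₀ · 2N` (the deep halves of Prop. (exp_equiv) (a), (b) for `A_{2j} = emb.embAltArmEvent j`;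
the inclusion halves are `embAltArmProb_outer_anti`, `embAltArmProb_inner_mono`), then for
`N₀ ≤ N ≤ N' ≤ 2ᵗN`, `n' ≤ n ≤ 2ᵗn'`, `c₀ 2ᵗ N' ≤ n'`:
`P_G[A_{2j}(N', n')] ≤ (c₁c₂)ᵗ · P_G[A_{2j}(N, n)]`.
[cite: GrimmettManolescu2014Isoradial, §8.2 Prop. (exp_equiv) (a)–(b) and §8.3–8.5 ("iterated"), k = 2j ≥ 4] -/
theorem _root_.Literature.Probability.LatticeModels.RhombicEmbedding.embAltArmProb_shrink_le
    [Countable V] (hiso : emb.IsIsoradial) (j : ℕ) {c₁ c₂ : ℝ} (hc₁ : 0 ≤ c₁) (hc₂ : 0 ≤ c₂)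
    {c₀ N₀ : ℕ} (hc₀ : 1 ≤ c₀)
    (ha : ∀ N n : ℕ, N₀ ≤ N → c₀ * N ≤ n →
      emb.isoradialPercolation.real (emb.embAltArmEvent j N n) ≤
        c₁ * emb.isoradialPercolation.real (emb.embAltArmEvent j N (2 * n)))
    (hb : ∀ N n : ℕ, N₀ ≤ N → c₀ * (2 * N) ≤ n →
      emb.isoradialPercolation.real (emb.embAltArmEvent j (2 * N) n) ≤
        c₂ * emb.isoradialPercolation.real (emb.embAltArmEvent j N n))
    (t : ℕ) {N N' n' n : ℕ} (hN : N₀ ≤ N) (hNN' : N ≤ N') (hN'K : N' ≤ 2 ^ t * N)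
    (hn'n : n' ≤ n) (hnK : n ≤ 2 ^ t * n') (hsc : c₀ * 2 ^ t * N' ≤ n') :
    emb.isoradialPercolation.real (emb.embAltArmEvent j N' n') ≤
      (c₁ * c₂) ^ t * emb.isoradialPercolation.real (emb.embAltArmEvent j N n) :=
  shrink_le (u := fun N n => emb.isoradialPercolation.real (emb.embAltArmEvent j N n))
    (fun _ _ _ hNn hnn' => emb.embAltArmProb_outer_anti hiso j hNn hnn')
    (fun _ _ _ hNN' hN'n => emb.embAltArmProb_inner_mono hiso j hNN' hN'n)
    hc₁ hc₂ hc₀ ha hb t hN hNN' hN'K hn'n hnK hsc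

/-- **Restoring the radii at constant cost, alternating `2j`-arm events**: under the deep halves
of Prop. (exp_equiv) (a), (b) for `A_{2j} = emb.embAltArmEvent j` (hypotheses `ha`, `hb`, printed
scope), for every factor `K` there are `C > 0` and `c ≥ 1` with
`P_G[A_{2j}(N', n')] ≤ C · P_G[A_{2j}(N, n)]` whenever `N₀ ≤ N ≤ N' ≤ KN`, `n' ≤ n ≤ Kn'`,
`cN' ≤ n'` — the step "`P[A_k(c_d N, c_d⁻¹ n)] ≤ c₄ P[A_k(N, n)]`" of §8.3–8.5 for `k = 2j ≥ 4`.
[cite: GrimmettManolescu2014Isoradial, §8.3 proof of Lemma (exp_transport1), last display but one, k = 2j ≥ 4] -/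
theorem _root_.Literature.Probability.LatticeModels.RhombicEmbedding.exists_embAltArmProb_shrink_le
    [Countable V] (hiso : emb.IsIsoradial) (j : ℕ) {c₁ c₂ : ℝ} (hc₁ : 0 < c₁) (hc₂ : 0 < c₂)
    {c₀ N₀ : ℕ} (hc₀ : 1 ≤ c₀)
    (ha : ∀ N n : ℕ, N₀ ≤ N → c₀ * N ≤ n →
      emb.isoradialPercolation.real (emb.embAltArmEvent j N n) ≤
        c₁ * emb.isoradialPercolation.real (emb.embAltArmEvent j N (2 * n)))
    (hb : ∀ N n : ℕ, N₀ ≤ N → c₀ * (2 * N) ≤ n →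
      emb.isoradialPercolation.real (emb.embAltArmEvent j (2 * N) n) ≤
        c₂ * emb.isoradialPercolation.real (emb.embAltArmEvent j N n))
    (K : ℕ) :
    ∃ C > (0 : ℝ), ∃ c : ℕ, 1 ≤ c ∧ ∀ N N' n' n : ℕ, N₀ ≤ N → N ≤ N' → N' ≤ K * N →
      n' ≤ n → n ≤ K * n' → c * N' ≤ n' →
        emb.isoradialPercolation.real (emb.embAltArmEvent j N' n') ≤
          C * emb.isoradialPercolation.real (emb.embAltArmEvent j N n) :=
  exists_shrink_le (u := fun N n => emb.isoradialPercolation.real (emb.embAltArmEvent j N n))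
    (fun _ _ _ hNn hnn' => emb.embAltArmProb_outer_anti hiso j hNn hnn')
    (fun _ _ _ hNN' hN'n => emb.embAltArmProb_inner_mono hiso j hNN' hN'n)
    hc₁ hc₂ hc₀ ha hb K

/-- **(exp_equiv_a)–(exp_equiv_b) iterated, for the arm events `A_κ = emb.embArmEvent κ`**
(`k ∈ {1, 2}` line of Prop. (exp_transport); every colour sequence `κ`): under the deep halves
`P_G[A_κ(N, n)] ≤ c₁ P_G[A_κ(N, 2n)]` (`N ≥ N₀`, `n ≥ c₀N`) and
`P_G[A_κ(2N, n)] ≤ c₂ P_G[A_κ(N, n)]` (`N ≥ N₀`, `n ≥ c₀ · 2N`), for `N₀ ≤ N ≤ N' ≤ 2ᵗN`,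
`n' ≤ n ≤ 2ᵗn'`, `c₀ 2ᵗ N' ≤ n'`: `P_G[A_κ(N', n')] ≤ (c₁c₂)ᵗ · P_G[A_κ(N, n)]`.
[cite: GrimmettManolescu2014Isoradial, §8.2 Prop. (exp_equiv) (a)–(b) and §8.3–8.5 ("iterated"), k ∈ {1, 2}] -/
theorem _root_.Literature.Probability.LatticeModels.RhombicEmbedding.embArmProb_shrink_le'
    [Countable V] (hiso : emb.IsIsoradial) {k : ℕ} (κ : Fin k → Bool) {c₁ c₂ : ℝ}
    (hc₁ : 0 ≤ c₁) (hc₂ : 0 ≤ c₂) {c₀ N₀ : ℕ} (hc₀ : 1 ≤ c₀)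
    (ha : ∀ N n : ℕ, N₀ ≤ N → c₀ * N ≤ n →
      emb.embArmProb κ N n ≤ c₁ * emb.embArmProb κ N (2 * n))
    (hb : ∀ N n : ℕ, N₀ ≤ N → c₀ * (2 * N) ≤ n →
      emb.embArmProb κ (2 * N) n ≤ c₂ * emb.embArmProb κ N n)
    (t : ℕ) {N N' n' n : ℕ} (hN : N₀ ≤ N) (hNN' : N ≤ N') (hN'K : N' ≤ 2 ^ t * N)
    (hn'n : n' ≤ n) (hnK : n ≤ 2 ^ t * n') (hsc : c₀ * 2 ^ t * N' ≤ n') :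
    emb.embArmProb κ N' n' ≤ (c₁ * c₂) ^ t * emb.embArmProb κ N n :=
  shrink_le (u := fun N n => emb.embArmProb κ N n)
    (fun _ _ _ hNn hnn' => emb.embArmProb_outer_anti hiso κ hNn hnn')
    (fun _ _ _ hNN' hN'n => emb.embArmProb_inner_mono hiso κ hNN' hN'n)
    hc₁ hc₂ hc₀ ha hb t hN hNN' hN'K hn'n hnK hsc

/-- **Restoring the radii at constant cost, arm events `A_κ`**: under the deep halves of
Prop. (exp_equiv) (a), (b) for `emb.embArmProb κ`, for every factor `K` there are `C > 0`,
`c ≥ 1` with `P_G[A_κ(N', n')] ≤ C · P_G[A_κ(N, n)]` whenever `N₀ ≤ N ≤ N' ≤ KN`,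
`n' ≤ n ≤ Kn'`, `cN' ≤ n'`.
[cite: GrimmettManolescu2014Isoradial, §8.3 proof of Lemma (exp_transport1), last display but one, k ∈ {1, 2}] -/
theorem _root_.Literature.Probability.LatticeModels.RhombicEmbedding.exists_embArmProb_shrink_le
    [Countable V] (hiso : emb.IsIsoradial) {k : ℕ} (κ : Fin k → Bool) {c₁ c₂ : ℝ}
    (hc₁ : 0 < c₁) (hc₂ : 0 < c₂) {c₀ N₀ : ℕ} (hc₀ : 1 ≤ c₀)
    (ha : ∀ N n : ℕ, N₀ ≤ N → c₀ * N ≤ n →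
      emb.embArmProb κ N n ≤ c₁ * emb.embArmProb κ N (2 * n))
    (hb : ∀ N n : ℕ, N₀ ≤ N → c₀ * (2 * N) ≤ n →
      emb.embArmProb κ (2 * N) n ≤ c₂ * emb.embArmProb κ N n)
    (K : ℕ) :
    ∃ C > (0 : ℝ), ∃ c : ℕ, 1 ≤ c ∧ ∀ N N' n' n : ℕ, N₀ ≤ N → N ≤ N' → N' ≤ K * N →
      n' ≤ n → n ≤ K * n' → c * N' ≤ n' → emb.embArmProb κ N' n' ≤ C * emb.embArmProb κ N n :=
  exists_shrink_le (u := fun N n => emb.embArmProb κ N n)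
    (fun _ _ _ hNn hnn' => emb.embArmProb_outer_anti hiso κ hNn hnn')
    (fun _ _ _ hNN' hN'n => emb.embArmProb_inner_mono hiso κ hNN' hN'n)
    hc₁ hc₂ hc₀ ha hb K

end Isoradial

end Literature.Probability.Percolation

end
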